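import Summits.RiemannHypothesis.RiemannHypothesis.Theorems.PfPersistenceNearLagCeiling
import HarnessLib

/-!
# PF-persistence cell — THE NEAR-LAG UP-DIAL SPLITTING LAW (odd sector, G1.02; companion of `PfPersistenceAutocorrSplitOdd`)

Framing (page 1): mechanism/rigidity campaign; no RH claims.  Every `theorem` below is PROVED (kernel-checked,
RH-free, weight-free: any `Weights`, any window); the words DATA / CONJECTURE in docstrings mark what is NOT proved here.

`PfPersistenceAutocorrSplitOdd` (119b16af3d09) is the odd law at FAR lags `a ≤ log p ≤ 2a` (`L = 2a`, ceiling `c = 0`).  With the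
NEAR-LAG CEILING LADDER (`PfPersistenceNearLagCeiling`: one-signed on `H` ⇒ `A⁻_u(log p) ≤ c_m‖u‖²`, `c_2 = 1/2` for
`log p ≥ a/2`, `c_3 = √2/2` for `log p ≥ a/3`, `c_4 = (1+√5)/4` for `log p ≥ a/4`; floored `+ 2φN`) the same one-line argument
runs at near lags.

THE LAW (§1 generic in the ceiling, §2 on the three rungs; window `win`, reached prime `p`, up-dial `1 ≤ K`, `0 ≤ w p`): if the
up-dial lowers the odd ground level by MORE than `2c_m·(K−1)·w(p)` then every bottom vector of the dialled odd block is NODAL on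
`H` (raw reader; floored reader with `2(c_m + 2φN)(K−1)w(p)`; `eo` handle by projection).  THRESHOLD form: one test vector
`v ≠ 0` with `vᵀQ⁻(w)v ≤ ℓ‖v‖²`, `τ‖v‖² ≤ A⁻_v(log p)` and `ℓ − ε₁(Q⁻(w)) < 2(K−1)·w(p)·(τ − c_m − 2φN)` rejects the dialled
datum; a `ζ` handle.  TEETH (§3): the pure mode `e_k` has `A⁻_{e_k} = θ⁻_{k+1,k+1}` (closed form), `= 1 − y/L > c_m` at a resonant
lag — nodal profiles beat the one-signed ceiling, so heavy enough near up-dials are PROVABLY rejected; the pure-mode certificate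
`midUpDial_not_mem_oddOneSignedAt_of_mode` is entirely closed-form on the left of `<`.  How heavy (the least certified `K − 1`
per window and prime) is DATA, not proved here.

NOT covered (CONJECTURE + DATA only): lags `log p < a/4`, the even sector along up-dials, odd DOWN-dials at near lags, and
anything about `ζ`'s actual membership in the odd readers at any window.
-/

set_option linter.dupNamespace false

noncomputable section

namespace Summit.RiemannHypothesis.RiemannHypothesis.Theorems.PfPersistence

open Real intervalIntegral MeasureTheory Matrix BigOperators Finset
open Summit.RiemannHypothesis.RiemannHypothesis.Theorems.PfPersistenceParityTransfer (thetaOdd)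

/-! ## §1 The law, generic in the ceiling -/

/-- **PROVED — THE UP-DIAL LEVEL-DROP LAW UNDER A CEILING.** Window `win`, reached prime `p`, up-dial `1 ≤ K`, `0 ≤ w p`,
and a class `P` of vectors with the autocorrelation ceiling `A⁻_u(log p) ≤ c‖u‖²` on `P`: if the up-dial lowers the odd
ground level by MORE than `2c·(K−1)·w(p)` then no bottom vector of the dialled odd block lies in `P`. (`c = 0`, `P` = one-signed
on `H`, far lags: the tree's `not_oneSignedOdd_of_farUpDial_levelDrop`.) [folklore] -/
theorem not_of_upDial_levelDrop_of_ceiling {win : Window} {p : ℕ} (hp : p ∈ primeRange (2 * win.a))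
    {K : ℝ} (hK : 1 ≤ K) {w : Weights} (hw : 0 ≤ w p) {c : ℝ} {P : (Fin win.N → ℝ) → Prop}
    (hceil : ∀ u, P u → oddAutocorr (2 * win.a) u (Real.log p) ≤ c * (u ⬝ᵥ u))
    (hdrop : bottomRayleigh (oddBlock (dial p K w) win)
      < bottomRayleigh (oddBlock w win) - 2 * c * ((K - 1) * w p))
    {u : Fin win.N → ℝ} (hu : IsBottomVector (oddBlock (dial p K w) win) u) : ¬ P u := by
  intro hPu
  have huu : 0 < u ⬝ᵥ u :=
    lt_of_le_of_ne (dotProduct_self_nonneg_real u) fun h => hu.1 (dotProduct_self_eq_zero.1 h.symm)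
  have h1 : u ⬝ᵥ (oddBlock (dial p K w) win *ᵥ u) = bottomRayleigh (oddBlock (dial p K w) win) * (u ⬝ᵥ u) := by
    rw [hu.2, dotProduct_smul, smul_eq_mul]
  have h2 := bottomRayleigh_mul_le_form (oddBlock w win) u
  have h3 := form_oddBlock_dial_eq_oddAutocorr hp K w u
  have hA := hceil u hPu
  have hc : 0 ≤ 2 * (K - 1) * w p := mul_nonneg (by linarith) hw
  have h4 := mul_le_mul_of_nonneg_left hA hc
  have h5 := mul_lt_mul_of_pos_right hdrop huu
  nlinarith

/-- **PROVED — THRESHOLD ⇒ LEVEL DROP WITH MARGIN.** A test vector `v ≠ 0` with `vᵀQ⁻(w)v ≤ ℓ‖v‖²` and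
`τ‖v‖² ≤ A⁻_v(log p)` certifies, for `1 ≤ K`, `0 ≤ w p` and any `c`, the drop
`ε₁(Q⁻(dial p K w)) < ε₁(Q⁻(w)) − 2c(K−1)w(p)` as soon as `ℓ − ε₁(Q⁻(w)) < 2(K−1)·w(p)·(τ − c)`. [folklore] -/
theorem upDial_levelDrop_of_threshold {win : Window} {p : ℕ} (hp : p ∈ primeRange (2 * win.a)) {K : ℝ} (hK : 1 ≤ K)
    {w : Weights} (hw : 0 ≤ w p) {v : Fin win.N → ℝ} (hv : v ≠ 0) {ℓ τ c : ℝ}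
    (hℓ : v ⬝ᵥ (oddBlock w win *ᵥ v) ≤ ℓ * (v ⬝ᵥ v)) (hτ : τ * (v ⬝ᵥ v) ≤ oddAutocorr (2 * win.a) v (Real.log p))
    (ht : ℓ - bottomRayleigh (oddBlock w win) < 2 * (K - 1) * w p * (τ - c)) :
    bottomRayleigh (oddBlock (dial p K w) win) < bottomRayleigh (oddBlock w win) - 2 * c * ((K - 1) * w p) := by
  have hvv : 0 < v ⬝ᵥ v :=
    lt_of_le_of_ne (dotProduct_self_nonneg_real v) fun h => hv (dotProduct_self_eq_zero.1 h.symm)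
  have h := bottomRayleigh_mul_le_form (oddBlock (dial p K w) win) v
  rw [form_oddBlock_dial_eq_oddAutocorr hp K w v] at h
  have hc : 0 ≤ 2 * (K - 1) * w p := mul_nonneg (by linarith) hw
  have h1 := mul_le_mul_of_nonneg_left hτ hc
  have h2 := mul_lt_mul_of_pos_right ht hvv
  have h3 : bottomRayleigh (oddBlock (dial p K w) win) * (v ⬝ᵥ v)
      < (bottomRayleigh (oddBlock w win) - 2 * c * ((K - 1) * w p)) * (v ⬝ᵥ v) := by nlinarith
  exact lt_of_mul_lt_mul_right h3 hvv.le

/-- PROVED (generic floored reader form): a ceiling `c` valid on the `φ`-floor one-signed class at lag `log p` plus the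
level drop with margin `2c(K−1)w(p)` rejects the dialled datum from `floorNodelessOddAt φ win`. [folklore] -/
theorem upDial_not_mem_floorNodelessOddAt_of_ceiling {win : Window} {p : ℕ} (hp : p ∈ primeRange (2 * win.a))
    {K : ℝ} (hK : 1 ≤ K) {w : Weights} (hw : 0 ≤ w p) {c φ : ℝ}
    (hceil : ∀ u : Fin win.N → ℝ, FloorOneSignedOdd (2 * win.a) φ u →
      oddAutocorr (2 * win.a) u (Real.log p) ≤ c * (u ⬝ᵥ u))
    (hdrop : bottomRayleigh (oddBlock (dial p K w) win)
      < bottomRayleigh (oddBlock w win) - 2 * c * ((K - 1) * w p)) :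
    datumOf (dial p K w) ∉ floorNodelessOddAt φ win := by
  rintro ⟨u, hu, hfl⟩
  rw [oddDatum_datumOf] at hu
  exact not_of_upDial_levelDrop_of_ceiling hp hK hw hceil hdrop hu hfl

/-- PROVED (generic raw reader form). [folklore] -/
theorem upDial_not_mem_oddOneSignedAt_of_ceiling {win : Window} {p : ℕ} (hp : p ∈ primeRange (2 * win.a))
    {K : ℝ} (hK : 1 ≤ K) {w : Weights} (hw : 0 ≤ w p) {c : ℝ}
    (hceil : ∀ u : Fin win.N → ℝ, OneSignedOdd (2 * win.a) u → oddAutocorr (2 * win.a) u (Real.log p) ≤ c * (u ⬝ᵥ u))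
    (hdrop : bottomRayleigh (oddBlock (dial p K w) win)
      < bottomRayleigh (oddBlock w win) - 2 * c * ((K - 1) * w p)) :
    datumOf (dial p K w) ∉ oddOneSignedAt win := by
  rintro ⟨u, hu, hone⟩
  rw [oddDatum_datumOf] at hu
  exact not_of_upDial_levelDrop_of_ceiling hp hK hw hceil hdrop hu hone

/-! ## §2 The near-lag law on the three rungs (`log p ≥ a/2`, `a/3`, `a/4`) -/

/-- **PROVED — MID-LAG UP-DIAL LAW (raw reader, `log p ≥ a/2`):** if the up-dial (`1 ≤ K`, `0 ≤ w p`) lowers the odd level by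
more than `(K−1)·w(p)` then `datumOf (dial p K w) ∉ oddOneSignedAt win`. [folklore] -/
theorem midUpDial_not_mem_oddOneSignedAt_of_levelDrop {win : Window} {p : ℕ} (hp : p ∈ primeRange (2 * win.a))
    (hmid : win.a / 2 ≤ Real.log p) {K : ℝ} (hK : 1 ≤ K) {w : Weights} (hw : 0 ≤ w p)
    (hdrop : bottomRayleigh (oddBlock (dial p K w) win) < bottomRayleigh (oddBlock w win) - (K - 1) * w p) :
    datumOf (dial p K w) ∉ oddOneSignedAt win := by
  have hL : 0 < 2 * win.a := by linarith [win.ha]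
  refine upDial_not_mem_oddOneSignedAt_of_ceiling hp hK hw (c := 1 / 2)
    (fun u hu => oddAutocorr_le_half_of_oneSignedOdd hL hu (by linarith)
      (log_le_of_mem_primeRange hL.le hp)) ?_
  linarith

/-- **PROVED — MID-LAG UP-DIAL LAW (floored reader, `log p ≥ a/2`):** a level drop by more than `(1 + 4φN)(K−1)w(p)` rejects
the dialled datum from `floorNodelessOddAt φ win` (`0 ≤ φ`). [folklore] -/
theorem midUpDial_not_mem_floorNodelessOddAt_of_levelDrop {win : Window} {p : ℕ} (hp : p ∈ primeRange (2 * win.a))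
    (hmid : win.a / 2 ≤ Real.log p) {K : ℝ} (hK : 1 ≤ K) {w : Weights} (hw : 0 ≤ w p) {φ : ℝ} (hφ : 0 ≤ φ)
    (hdrop : bottomRayleigh (oddBlock (dial p K w) win)
      < bottomRayleigh (oddBlock w win) - (1 + 4 * φ * win.N) * ((K - 1) * w p)) :
    datumOf (dial p K w) ∉ floorNodelessOddAt φ win := by
  have hL : 0 < 2 * win.a := by linarith [win.ha]
  refine upDial_not_mem_floorNodelessOddAt_of_ceiling hp hK hw (c := 1 / 2 + 2 * φ * win.N)
    (fun u hu => oddAutocorr_le_of_floorOneSignedOdd_mid hL hφ hu (by linarith)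
      (log_le_of_mem_primeRange hL.le hp)) ?_
  have e : 2 * (1 / 2 + 2 * φ * win.N) * ((K - 1) * w p) = (1 + 4 * φ * win.N) * ((K - 1) * w p) := by ring
  rw [e]; exact hdrop

/-- PROVED (`eo` handle): the same hypotheses reject the dialled datum from `floorNodelessEOAt φ win`. [folklore] -/
theorem midUpDial_not_mem_floorNodelessEOAt_of_levelDrop {win : Window} {p : ℕ} (hp : p ∈ primeRange (2 * win.a))
    (hmid : win.a / 2 ≤ Real.log p) {K : ℝ} (hK : 1 ≤ K) {w : Weights} (hw : 0 ≤ w p) {φ : ℝ} (hφ : 0 ≤ φ)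
    (hdrop : bottomRayleigh (oddBlock (dial p K w) win)
      < bottomRayleigh (oddBlock w win) - (1 + 4 * φ * win.N) * ((K - 1) * w p)) :
    datumOf (dial p K w) ∉ floorNodelessEOAt φ win :=
  fun h => midUpDial_not_mem_floorNodelessOddAt_of_levelDrop hp hmid hK hw hφ hdrop h.2

/-- **PROVED — MID-LAG THRESHOLD ⇒ REJECTION (floored).** `log p ≥ a/2`, `1 ≤ K`, `0 ≤ w p`, `0 ≤ φ`, a test vector
`v ≠ 0` with `vᵀQ⁻(w)v ≤ ℓ‖v‖²`, `τ‖v‖² ≤ A⁻_v(log p)` and `ℓ − ε₁(Q⁻(w)) < 2(K−1)·w(p)·(τ − 1/2 − 2φN)`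
⇒ `datumOf (dial p K w) ∉ floorNodelessOddAt φ win`. [folklore] -/
theorem midUpDial_not_mem_floorNodelessOddAt_of_threshold {win : Window} {p : ℕ} (hp : p ∈ primeRange (2 * win.a))
    (hmid : win.a / 2 ≤ Real.log p) {K : ℝ} (hK : 1 ≤ K) {w : Weights} (hw : 0 ≤ w p) {φ : ℝ} (hφ : 0 ≤ φ)
    {v : Fin win.N → ℝ} (hv : v ≠ 0) {ℓ τ : ℝ} (hℓ : v ⬝ᵥ (oddBlock w win *ᵥ v) ≤ ℓ * (v ⬝ᵥ v))
    (hτ : τ * (v ⬝ᵥ v) ≤ oddAutocorr (2 * win.a) v (Real.log p))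
    (ht : ℓ - bottomRayleigh (oddBlock w win) < 2 * (K - 1) * w p * (τ - 1 / 2 - 2 * φ * win.N)) :
    datumOf (dial p K w) ∉ floorNodelessOddAt φ win := by
  have hL : 0 < 2 * win.a := by linarith [win.ha]
  refine upDial_not_mem_floorNodelessOddAt_of_ceiling hp hK hw (c := 1 / 2 + 2 * φ * win.N)
    (fun u hu => oddAutocorr_le_of_floorOneSignedOdd_mid hL hφ hu (by linarith)
      (log_le_of_mem_primeRange hL.le hp)) ?_
  refine upDial_levelDrop_of_threshold hp hK hw hv hℓ hτ ?_
  have e : τ - (1 / 2 + 2 * φ * win.N) = τ - 1 / 2 - 2 * φ * win.N := by ring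
  rw [e]; exact ht

/-- PROVED (`eo` handle, threshold form). [folklore] -/
theorem midUpDial_not_mem_floorNodelessEOAt_of_threshold {win : Window} {p : ℕ} (hp : p ∈ primeRange (2 * win.a))
    (hmid : win.a / 2 ≤ Real.log p) {K : ℝ} (hK : 1 ≤ K) {w : Weights} (hw : 0 ≤ w p) {φ : ℝ} (hφ : 0 ≤ φ)
    {v : Fin win.N → ℝ} (hv : v ≠ 0) {ℓ τ : ℝ} (hℓ : v ⬝ᵥ (oddBlock w win *ᵥ v) ≤ ℓ * (v ⬝ᵥ v))
    (hτ : τ * (v ⬝ᵥ v) ≤ oddAutocorr (2 * win.a) v (Real.log p))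
    (ht : ℓ - bottomRayleigh (oddBlock w win) < 2 * (K - 1) * w p * (τ - 1 / 2 - 2 * φ * win.N)) :
    datumOf (dial p K w) ∉ floorNodelessEOAt φ win :=
  fun h => midUpDial_not_mem_floorNodelessOddAt_of_threshold hp hmid hK hw hφ hv hℓ hτ ht h.2

/-- PROVED (raw threshold form, `φ = 0`): `ℓ − ε₁(Q⁻(w)) < 2(K−1)·w(p)·(τ − 1/2)` ⇒ `datumOf (dial p K w) ∉ oddOneSignedAt win`.
[folklore] -/
theorem midUpDial_not_mem_oddOneSignedAt_of_threshold {win : Window} {p : ℕ} (hp : p ∈ primeRange (2 * win.a))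
    (hmid : win.a / 2 ≤ Real.log p) {K : ℝ} (hK : 1 ≤ K) {w : Weights} (hw : 0 ≤ w p)
    {v : Fin win.N → ℝ} (hv : v ≠ 0) {ℓ τ : ℝ} (hℓ : v ⬝ᵥ (oddBlock w win *ᵥ v) ≤ ℓ * (v ⬝ᵥ v))
    (hτ : τ * (v ⬝ᵥ v) ≤ oddAutocorr (2 * win.a) v (Real.log p))
    (ht : ℓ - bottomRayleigh (oddBlock w win) < 2 * (K - 1) * w p * (τ - 1 / 2)) :
    datumOf (dial p K w) ∉ oddOneSignedAt win := by
  rw [← floorNodelessOddAt_zero]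
  refine midUpDial_not_mem_floorNodelessOddAt_of_threshold hp hmid hK hw le_rfl hv hℓ hτ ?_
  simpa using ht

/-- PROVED (`ζ` handle): for `zetaWeights` (`0 ≤ w p` automatic) the mid-lag threshold certificate — whose premises
`hℓ`, `hτ`, `ht` are DATA wherever asserted for an actual `(win, p, K, v)` — rejects the dialled datum from
`floorNodelessOddAt φ win`.  Nothing here asserts the premises for any actual window. [folklore] -/
theorem zeta_midUpDial_not_mem_floorNodelessOddAt_of_threshold {win : Window} {p : ℕ}
    (hp : p ∈ primeRange (2 * win.a)) (hmid : win.a / 2 ≤ Real.log p) {K : ℝ} (hK : 1 ≤ K) {φ : ℝ} (hφ : 0 ≤ φ)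
    {v : Fin win.N → ℝ} (hv : v ≠ 0) {ℓ τ : ℝ} (hℓ : v ⬝ᵥ (oddBlock zetaWeights win *ᵥ v) ≤ ℓ * (v ⬝ᵥ v))
    (hτ : τ * (v ⬝ᵥ v) ≤ oddAutocorr (2 * win.a) v (Real.log p))
    (ht : ℓ - bottomRayleigh (oddBlock zetaWeights win)
      < 2 * (K - 1) * zetaWeights p * (τ - 1 / 2 - 2 * φ * win.N)) :
    datumOf (dial p K zetaWeights) ∉ floorNodelessOddAt φ win :=
  midUpDial_not_mem_floorNodelessOddAt_of_threshold hp hmid hK (zetaWeights_nonneg p) hφ hv hℓ hτ ht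

/-- **PROVED — RUNG-3 UP-DIAL LAW (floored reader, `log p ≥ a/3`):** a level drop by more than `(√2 + 4φN)(K−1)w(p)` rejects
the dialled datum from `floorNodelessOddAt φ win`. [folklore] -/
theorem thirdUpDial_not_mem_floorNodelessOddAt_of_levelDrop {win : Window} {p : ℕ} (hp : p ∈ primeRange (2 * win.a))
    (hthird : win.a / 3 ≤ Real.log p) {K : ℝ} (hK : 1 ≤ K) {w : Weights} (hw : 0 ≤ w p) {φ : ℝ} (hφ : 0 ≤ φ)
    (hdrop : bottomRayleigh (oddBlock (dial p K w) win)
      < bottomRayleigh (oddBlock w win) - (Real.sqrt 2 + 4 * φ * win.N) * ((K - 1) * w p)) :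
    datumOf (dial p K w) ∉ floorNodelessOddAt φ win := by
  have hL : 0 < 2 * win.a := by linarith [win.ha]
  refine upDial_not_mem_floorNodelessOddAt_of_ceiling hp hK hw (c := Real.sqrt 2 / 2 + 2 * φ * win.N)
    (fun u hu => oddAutocorr_le_of_floorOneSignedOdd_third hL hφ hu (by linarith)
      (log_le_of_mem_primeRange hL.le hp)) ?_
  have e : 2 * (Real.sqrt 2 / 2 + 2 * φ * win.N) * ((K - 1) * w p)
      = (Real.sqrt 2 + 4 * φ * win.N) * ((K - 1) * w p) := by ring
  rw [e]; exact hdrop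

/-- **PROVED — RUNG-3 THRESHOLD ⇒ REJECTION (floored, `log p ≥ a/3`):** `ℓ − ε₁(Q⁻(w)) < 2(K−1)·w(p)·(τ − √2/2 − 2φN)` ⇒
`datumOf (dial p K w) ∉ floorNodelessOddAt φ win`. [folklore] -/
theorem thirdUpDial_not_mem_floorNodelessOddAt_of_threshold {win : Window} {p : ℕ} (hp : p ∈ primeRange (2 * win.a))
    (hthird : win.a / 3 ≤ Real.log p) {K : ℝ} (hK : 1 ≤ K) {w : Weights} (hw : 0 ≤ w p) {φ : ℝ} (hφ : 0 ≤ φ)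
    {v : Fin win.N → ℝ} (hv : v ≠ 0) {ℓ τ : ℝ} (hℓ : v ⬝ᵥ (oddBlock w win *ᵥ v) ≤ ℓ * (v ⬝ᵥ v))
    (hτ : τ * (v ⬝ᵥ v) ≤ oddAutocorr (2 * win.a) v (Real.log p))
    (ht : ℓ - bottomRayleigh (oddBlock w win) < 2 * (K - 1) * w p * (τ - Real.sqrt 2 / 2 - 2 * φ * win.N)) :
    datumOf (dial p K w) ∉ floorNodelessOddAt φ win := by
  have hL : 0 < 2 * win.a := by linarith [win.ha]
  refine upDial_not_mem_floorNodelessOddAt_of_ceiling hp hK hw (c := Real.sqrt 2 / 2 + 2 * φ * win.N)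
    (fun u hu => oddAutocorr_le_of_floorOneSignedOdd_third hL hφ hu (by linarith)
      (log_le_of_mem_primeRange hL.le hp)) ?_
  refine upDial_levelDrop_of_threshold hp hK hw hv hℓ hτ ?_
  have e : τ - (Real.sqrt 2 / 2 + 2 * φ * win.N) = τ - Real.sqrt 2 / 2 - 2 * φ * win.N := by ring
  rw [e]; exact ht

/-- PROVED (rung 3, `eo` handle, threshold form). [folklore] -/
theorem thirdUpDial_not_mem_floorNodelessEOAt_of_threshold {win : Window} {p : ℕ} (hp : p ∈ primeRange (2 * win.a))
    (hthird : win.a / 3 ≤ Real.log p) {K : ℝ} (hK : 1 ≤ K) {w : Weights} (hw : 0 ≤ w p) {φ : ℝ} (hφ : 0 ≤ φ)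
    {v : Fin win.N → ℝ} (hv : v ≠ 0) {ℓ τ : ℝ} (hℓ : v ⬝ᵥ (oddBlock w win *ᵥ v) ≤ ℓ * (v ⬝ᵥ v))
    (hτ : τ * (v ⬝ᵥ v) ≤ oddAutocorr (2 * win.a) v (Real.log p))
    (ht : ℓ - bottomRayleigh (oddBlock w win) < 2 * (K - 1) * w p * (τ - Real.sqrt 2 / 2 - 2 * φ * win.N)) :
    datumOf (dial p K w) ∉ floorNodelessEOAt φ win :=
  fun h => thirdUpDial_not_mem_floorNodelessOddAt_of_threshold hp hthird hK hw hφ hv hℓ hτ ht h.2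

/-- **PROVED — RUNG-4 UP-DIAL LAW (floored reader, `log p ≥ a/4`):** a level drop by more than `((1+√5)/2 + 4φN)(K−1)w(p)`
rejects the dialled datum from `floorNodelessOddAt φ win`. [folklore] -/
theorem quarterUpDial_not_mem_floorNodelessOddAt_of_levelDrop {win : Window} {p : ℕ} (hp : p ∈ primeRange (2 * win.a))
    (hq : win.a / 4 ≤ Real.log p) {K : ℝ} (hK : 1 ≤ K) {w : Weights} (hw : 0 ≤ w p) {φ : ℝ} (hφ : 0 ≤ φ)
    (hdrop : bottomRayleigh (oddBlock (dial p K w) win)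
      < bottomRayleigh (oddBlock w win) - ((1 + Real.sqrt 5) / 2 + 4 * φ * win.N) * ((K - 1) * w p)) :
    datumOf (dial p K w) ∉ floorNodelessOddAt φ win := by
  have hL : 0 < 2 * win.a := by linarith [win.ha]
  refine upDial_not_mem_floorNodelessOddAt_of_ceiling hp hK hw (c := (1 + Real.sqrt 5) / 4 + 2 * φ * win.N)
    (fun u hu => oddAutocorr_le_of_floorOneSignedOdd_quarter hL hφ hu (by linarith)
      (log_le_of_mem_primeRange hL.le hp)) ?_
  have e : 2 * ((1 + Real.sqrt 5) / 4 + 2 * φ * win.N) * ((K - 1) * w p)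
      = ((1 + Real.sqrt 5) / 2 + 4 * φ * win.N) * ((K - 1) * w p) := by ring
  rw [e]; exact hdrop

/-- **PROVED — RUNG-4 THRESHOLD ⇒ REJECTION (floored, `log p ≥ a/4`):**
`ℓ − ε₁(Q⁻(w)) < 2(K−1)·w(p)·(τ − (1+√5)/4 − 2φN)` ⇒ `datumOf (dial p K w) ∉ floorNodelessOddAt φ win`. [folklore] -/
theorem quarterUpDial_not_mem_floorNodelessOddAt_of_threshold {win : Window} {p : ℕ} (hp : p ∈ primeRange (2 * win.a))
    (hq : win.a / 4 ≤ Real.log p) {K : ℝ} (hK : 1 ≤ K) {w : Weights} (hw : 0 ≤ w p) {φ : ℝ} (hφ : 0 ≤ φ)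
    {v : Fin win.N → ℝ} (hv : v ≠ 0) {ℓ τ : ℝ} (hℓ : v ⬝ᵥ (oddBlock w win *ᵥ v) ≤ ℓ * (v ⬝ᵥ v))
    (hτ : τ * (v ⬝ᵥ v) ≤ oddAutocorr (2 * win.a) v (Real.log p))
    (ht : ℓ - bottomRayleigh (oddBlock w win)
      < 2 * (K - 1) * w p * (τ - (1 + Real.sqrt 5) / 4 - 2 * φ * win.N)) :
    datumOf (dial p K w) ∉ floorNodelessOddAt φ win := by
  have hL : 0 < 2 * win.a := by linarith [win.ha]
  refine upDial_not_mem_floorNodelessOddAt_of_ceiling hp hK hw (c := (1 + Real.sqrt 5) / 4 + 2 * φ * win.N)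
    (fun u hu => oddAutocorr_le_of_floorOneSignedOdd_quarter hL hφ hu (by linarith)
      (log_le_of_mem_primeRange hL.le hp)) ?_
  refine upDial_levelDrop_of_threshold hp hK hw hv hℓ hτ ?_
  have e : τ - ((1 + Real.sqrt 5) / 4 + 2 * φ * win.N) = τ - (1 + Real.sqrt 5) / 4 - 2 * φ * win.N := by ring
  rw [e]; exact ht

/-- PROVED (rung 4, `eo` handle, threshold form). [folklore] -/
theorem quarterUpDial_not_mem_floorNodelessEOAt_of_threshold {win : Window} {p : ℕ} (hp : p ∈ primeRange (2 * win.a))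
    (hq : win.a / 4 ≤ Real.log p) {K : ℝ} (hK : 1 ≤ K) {w : Weights} (hw : 0 ≤ w p) {φ : ℝ} (hφ : 0 ≤ φ)
    {v : Fin win.N → ℝ} (hv : v ≠ 0) {ℓ τ : ℝ} (hℓ : v ⬝ᵥ (oddBlock w win *ᵥ v) ≤ ℓ * (v ⬝ᵥ v))
    (hτ : τ * (v ⬝ᵥ v) ≤ oddAutocorr (2 * win.a) v (Real.log p))
    (ht : ℓ - bottomRayleigh (oddBlock w win)
      < 2 * (K - 1) * w p * (τ - (1 + Real.sqrt 5) / 4 - 2 * φ * win.N)) :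
    datumOf (dial p K w) ∉ floorNodelessEOAt φ win :=
  fun h => quarterUpDial_not_mem_floorNodelessOddAt_of_threshold hp hq hK hw hφ hv hℓ hτ ht h.2

/-! ## §3 Teeth: the pure modes as explicit test vectors -/

/-- **PROVED — THE PURE-MODE AUTOCORRELATION IS CONNES' `θ⁻` DIAGONAL:** the basis vector `e_k` (mode `n = k+1`) has
`A⁻_{e_k}(y) = θ⁻_{k+1,k+1}(y)`. [folklore] -/
theorem oddAutocorr_single_eq_thetaOdd {L : ℝ} (hL : 0 < L) {N : ℕ} (k : Fin N) (y : ℝ) :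
    oddAutocorr L (Pi.single k (1:ℝ)) y = thetaOdd L ((k : ℕ) + 1) ((k : ℕ) + 1) y := by
  rw [← sum_thetaOdd_eq_oddAutocorr hL]
  simp [Pi.single_apply]

/-- **PROVED — THE PURE-MODE AUTOCORRELATION, CLOSED FORM:**
`A⁻_{e_k}(y) = (L−y)/L·cos(2π(k+1)y/L) + sin(2π(k+1)y/L)/(2π(k+1))` (`0 < L`); at a resonant lag (`(k+1)y/L ∈ ℤ`) this is
`1 − y/L`, which exceeds every rung's ceiling `c_m` on `L/(2m) ≤ y < L(1 − c_m)` — nodal profiles beat the one-signed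
ceiling. [folklore] -/
theorem oddAutocorr_single {L : ℝ} (hL : 0 < L) {N : ℕ} (k : Fin N) (y : ℝ) :
    oddAutocorr L (Pi.single k (1:ℝ)) y
      = (L - y) / L * Real.cos (2 * π * (((k : ℕ) : ℝ) + 1) * y / L)
        + Real.sin (2 * π * (((k : ℕ) : ℝ) + 1) * y / L) / (2 * π * (((k : ℕ) : ℝ) + 1)) := by
  rw [oddAutocorr_single_eq_thetaOdd hL]
  simp [thetaOdd]

/-- PROVED: `‖e_k‖² = 1`. [folklore] -/
theorem dotProduct_single_self {N : ℕ} (k : Fin N) : Pi.single k (1:ℝ) ⬝ᵥ Pi.single k (1:ℝ) = 1 := by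
  simp

/-- **PROVED — THE PURE-MODE MID-LAG CERTIFICATE (raw reader):** `log p ≥ a/2`, `1 ≤ K`, `0 ≤ w p`; if for some mode `k`
the diagonal entry `Q⁻(w)_{kk}` and the closed-form mode autocorrelation `θ⁻_{k+1,k+1}(log p)` satisfy
`Q⁻(w)_{kk} − ε₁(Q⁻(w)) < 2(K−1)·w(p)·(θ⁻_{k+1,k+1}(log p) − 1/2)`, then `datumOf (dial p K w) ∉ oddOneSignedAt win`.
(Everything on the left of `<` is a finite closed-form / algebraic quantity of the reference table.) [folklore] -/
theorem midUpDial_not_mem_oddOneSignedAt_of_mode {win : Window} {p : ℕ} (hp : p ∈ primeRange (2 * win.a))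
    (hmid : win.a / 2 ≤ Real.log p) {K : ℝ} (hK : 1 ≤ K) {w : Weights} (hw : 0 ≤ w p) (k : Fin win.N)
    (ht : Pi.single k (1:ℝ) ⬝ᵥ (oddBlock w win *ᵥ Pi.single k (1:ℝ)) - bottomRayleigh (oddBlock w win)
      < 2 * (K - 1) * w p * (oddAutocorr (2 * win.a) (Pi.single k (1:ℝ)) (Real.log p) - 1 / 2)) :
    datumOf (dial p K w) ∉ oddOneSignedAt win := by
  have hv : (Pi.single k (1:ℝ) : Fin win.N → ℝ) ≠ 0 := by
    intro h
    have := congrFun h k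
    simp at this
  refine midUpDial_not_mem_oddOneSignedAt_of_threshold hp hmid hK hw hv
    (ℓ := Pi.single k (1:ℝ) ⬝ᵥ (oddBlock w win *ᵥ Pi.single k (1:ℝ)))
    (τ := oddAutocorr (2 * win.a) (Pi.single k (1:ℝ)) (Real.log p)) ?_ ?_ ht
  · rw [dotProduct_single_self, mul_one]
  · rw [dotProduct_single_self, mul_one]

end Summit.RiemannHypothesis.RiemannHypothesis.Theorems.PfPersistence

end
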